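import Mathlib
import HarnessLib
import Literature.MathematicalPhysics.QuantumLattice.GrassmannGaussianQuadraticInsertion
import Literature.MathematicalPhysics.QuantumLattice.GrassmannLaplacianPairWick

/-!
# Gaussian change of covariance in Laplacian form: a quadratic perturbation of the weight IS a change of covariance
# (child 4 `KLRegimeTwoPointAssembly` of crux K3, stub `stub_asm_frame` — generic layer)

For a covariance `C` with pair function `A = contr C`, an even quadratic-type element `q` without constant part whose derivatives are
linear in the generators (`∂_Y q = Σ_W S(Y,W) ψ(W)`), a matrix `T` with `T (1 + A S) = 1`, and ANY covariance `C'` whose pair function is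
`T A`: for every `F`,

  `∫ dμ_C e^{-q} F = (∫ dμ_C e^{-q}) · ∫ dμ_{C'} F`

— the functional `F ↦ ∫dμ_C e^{-q}F` obeys Wick's rule with pair function `(1 + A S)⁻¹ A` (integration by parts and
`∂_Y e^{-q} = -e^{-q} ∂_Y q`), hence is a multiple of `∫dμ_{C'}` by uniqueness of Wick functionals (`eq_smul_gaussExpect_of_wick`;
Feldman–Knörrer–Trubowitz 2002 §I.3; Dimock–Yuan 2024 App. B Lemma 24, the tree's two-species `…grassmannExp_neg_quadratic_mul`, here for
ANY finite label set without Berezin orientation or matrix inverses).  Used with `C = C^K` (countertermed Hubbard covariance), `q = 𝒩_K`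
(counterterm vertex), `C' = C` (bare): same model, frame moved.
-/

noncomputable section

namespace Summit.HubbardSuperconductivity.HubbardSuperconductivity.Theorems.TwoPointAssembly

set_option linter.dupNamespace false -- summit = problem name (single-conjunct summit), D-0017

open Literature.MathematicalPhysics.QuantumLattice GrassmannAlgebra Finset

variable (R : Type*) [CommRing R] [Algebra ℚ R] {Γ : Type*} [Fintype Γ] [DecidableEq Γ]

/-- **Gaussian change of covariance (Laplacian form, any finite label set).**  See the module docstring. -/
theorem gaussExpect_grassmannExp_neg_mul_eq_mul (C C' : Matrix Γ Γ R) {q : GrassmannAlgebra R Γ} (S T : Matrix Γ Γ R)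
    (hq0 : q ∈ evenOdd R 0) (hqc : constPart R q = 0)
    (hdq : ∀ Y, grassmannDeriv R Y q = ∑ W, S Y W • gen R W)
    (hT : ∀ X Z, ∑ Y, T X Y * ((if Y = Z then 1 else 0) + ∑ W, contr R C Y W * S W Z) = if X = Z then 1 else 0)
    (hC' : ∀ X Y, contr R C' X Y = ∑ Z, T X Z * contr R C Z Y) (F : GrassmannAlgebra R Γ) :
    gaussExpect R C (grassmannExp (-q) * F) = gaussExpect R C (grassmannExp (-q)) * gaussExpect R C' F := by
  set Φ : GrassmannAlgebra R Γ →ₗ[R] R := gaussExpect R C ∘ₗ LinearMap.mulLeft R (grassmannExp (-q)) with hΦdef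
  have hΦapp : ∀ G, Φ G = gaussExpect R C (grassmannExp (-q) * G) := fun G => rfl
  have hnq0 : -q ∈ evenOdd R 0 := neg_mem hq0
  have hnqn : IsNilpotent (-q) := isNilpotent_of_constPart_eq_zero R (by rw [map_neg, hqc, neg_zero])
  have hE0 : grassmannExp (-q) ∈ evenOdd R 0 := grassmannExp_mem_evenOdd_zero R hnq0 hnqn
  have hdE : ∀ Y, grassmannDeriv R Y (grassmannExp (-q)) = -(grassmannExp (-q) * ∑ W, S Y W • gen R W) := by
    intro Y
    rw [grassmannDeriv_grassmannExp_of_mem_evenOdd_zero R Y hnq0 hnqn, map_neg, hdq, mul_neg]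
  -- Step 1: integration by parts past `ψ(X)`, with the weight's derivative producing the `S`-term
  have hraw : ∀ (X : Γ) (a : GrassmannAlgebra R Γ),
      Φ (gen R X * a) + ∑ W, (∑ Y, contr R C X Y * S Y W) * Φ (gen R W * a) =
        ∑ Y, contr R C X Y * Φ (grassmannDeriv R Y a) := by
    intro X a
    have h1 : Φ (gen R X * a) = ∑ Y, contr R C X Y * gaussExpect R C (grassmannDeriv R Y (grassmannExp (-q) * a)) := by
      rw [hΦapp, ← mul_assoc, (commute_of_mem_evenOdd_zero R hE0 (gen R X)).eq, mul_assoc, gaussExpect_gen_mul]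
      simp only [← contr_apply]
    have h2 : ∀ Y, gaussExpect R C (grassmannDeriv R Y (grassmannExp (-q) * a)) =
        Φ (grassmannDeriv R Y a) - ∑ W, S Y W * Φ (gen R W * a) := by
      intro Y
      rw [grassmannDeriv_mul_of_mem_evenOdd_zero R Y hE0, hdE, map_add, ← hΦapp, neg_mul, map_neg, Finset.mul_sum,
        Finset.sum_mul, map_sum]
      simp only [smul_mul_assoc, mul_smul_comm, map_smul, smul_eq_mul]
      simp only [mul_assoc, ← hΦapp]
      ring
    rw [h1]
    simp only [h2, mul_sub, Finset.sum_sub_distrib, Finset.mul_sum, Finset.sum_mul]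
    rw [Finset.sum_comm (f := fun W Y => contr R C X Y * S Y W * Φ (gen R W * a))]
    simp only [mul_assoc]
    abel
  -- Step 2: solve the linear system with `T`
  have hwick : ∀ (X : Γ) (a : GrassmannAlgebra R Γ),
      Φ (gen R X * a) = ∑ Y, contr R C' X Y * Φ (grassmannDeriv R Y a) := by
    intro X a
    have hsum : ∑ X', T X X' * (Φ (gen R X' * a) + ∑ W, (∑ Y, contr R C X' Y * S Y W) * Φ (gen R W * a)) =
        ∑ X', T X X' * ∑ Y, contr R C X' Y * Φ (grassmannDeriv R Y a) :=
      Finset.sum_congr rfl fun X' _ => by rw [hraw X' a]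
    -- left side collapses to `Φ (ψ(X) a)` by `hT`
    have hL : ∑ X', T X X' * (Φ (gen R X' * a) + ∑ W, (∑ Y, contr R C X' Y * S Y W) * Φ (gen R W * a)) =
        Φ (gen R X * a) := by
      have : ∀ X', Φ (gen R X' * a) + ∑ W, (∑ Y, contr R C X' Y * S Y W) * Φ (gen R W * a) =
          ∑ W, ((if X' = W then 1 else 0) + ∑ Y, contr R C X' Y * S Y W) * Φ (gen R W * a) := by
        intro X'
        simp only [add_mul, Finset.sum_add_distrib, ite_mul, one_mul, zero_mul, Finset.sum_ite_eq, Finset.mem_univ,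
          if_true]
      simp only [this, Finset.mul_sum, ← mul_assoc]
      rw [Finset.sum_comm]
      simp only [← Finset.sum_mul, hT, ite_mul, one_mul, zero_mul, Finset.sum_ite_eq, Finset.mem_univ, if_true]
    -- right side is the `C'` pairing
    have hRt : ∑ X', T X X' * ∑ Y, contr R C X' Y * Φ (grassmannDeriv R Y a) =
        ∑ Y, contr R C' X Y * Φ (grassmannDeriv R Y a) := by
      simp only [Finset.mul_sum, ← mul_assoc]
      rw [Finset.sum_comm]
      simp only [← Finset.sum_mul, ← hC']
    rw [← hL, hsum, hRt]
  -- Step 3: uniqueness of Wick functionals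
  have hΦ : ∀ (X : Γ) (a : GrassmannAlgebra R Γ),
      Φ (gen R X * a) = ∑ Y, (((1 / 2 : ℚ) • (1 : R)) * (C' Y X - C' X Y)) * Φ (grassmannDeriv R Y a) := by
    intro X a; simpa only [contr_apply] using hwick X a
  have h := eq_smul_gaussExpect_of_wick R Φ C' hΦ
  have hF := LinearMap.congr_fun h F
  rw [LinearMap.smul_apply, smul_eq_mul, hΦapp, hΦapp, mul_one] at hF
  exact hF

end Summit.HubbardSuperconductivity.HubbardSuperconductivity.Theorems.TwoPointAssembly

end
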